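import Literature.Analysis.FunctionSpaces.MellinPlancherelL2
import Mathlib.MeasureTheory.Function.ConvergenceInMeasure
import HarnessLib

/-!
# Boundary values on the critical line of Mellin transforms of `L²` functions supported away from `0`

RH-FREE infrastructure (real/harmonic analysis on the half-line; cell rh-crit, row «dbl:R18-M3»;
bears_on LADDER-RH COLUMN 6 (DBR) as TOOLING ONLY). WHAT THIS IS NOT: nothing in this file mentions
`ζ`, its zeros or RH; nothing here bears on the truth of RH.

Setting: the Mellin–Plancherel transform `MellinL2.mellinL2 : L²((0,∞),dt) ≃ₗᵢ L²(ℝ, dξ)` of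
`MellinPlancherelL2.lean` (critical line `s = ½ + 2πiξ`, LEFT Mellin transform `𝓜k(s) = ∫₀^∞ k(t)t^{s−1}dt`,
Mathlib's `mellin`).  For `k ∈ L²(0,∞)` vanishing a.e. on `(0,a]` (`a > 0`) — Burnol's Hardy side:
in his right-Mellin notation `k̂(w) = ∫₀^∞ k(t)t^{−w}dt = 𝓜k(1 − w)` these are the `k` with `k̂` in the
Hardy space of `Re w > ½` [Burnol2004b, §4, TeX l.626–645] — the Mellin integral converges absolutely on
the open half-plane `Re s < ½` (`mellinConvergent_of_ae_eq_zero`, Cauchy–Schwarz against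
`t^{Re s−1} ∈ L²(a,∞)`), and the main statements are:

* `tendsto_eLpNorm_cpow_smul_sub` — `k_ε := t^{−ε}k → k` in `L²((0,∞))` as `ε → 0⁺` (dominated
  convergence);
* `mellinL2_toLp_cpow_smul_ae_eq` — `mellinL2 [k_ε] = (ξ ↦ 𝓜k(½ − ε + 2πiξ))` a.e. (`ε > 0`; the
  dictionary of `MellinPlancherelL2` + Mathlib `mellin_cpow_smul`);
* `tendsto_eLpNorm_mellin_sub_mellinL2` — **boundary values in `L²`**: the functions
  `ξ ↦ 𝓜k(½ − ε + 2πiξ)` converge to (a representative of) `mellinL2 k` in `L²(ℝ)`-seminorm as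
  `ε → 0⁺` (in Burnol's notation: `τ ↦ k̂(½ + ε + iτ) → k̂(½ + iτ)` in `L²`, the Hardy-space boundary
  value, here obtained without Hardy-space theory because `mellinL2` is an isometry);
* `mellinL2_ae_eq_of_continuousWithinAt` (functions with `MemLp`) / `…'` (`L²` classes) — **the
  identification actually consumed** (row (ii′) of
  `Burnol2004b_prop4_1R`): if `K` agrees with `𝓜k` on a strip `½ − δ < Re s < ½` and is continuous
  from the open half-plane `Re s < ½` at a.e. point of the critical line, then
  `mellinL2 k = (ξ ↦ K(½ + 2πiξ))` a.e. (an `L²` limit is an a.e. limit along a subsequence: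
  Mathlib `tendstoInMeasure_of_tendsto_eLpNorm`, `TendstoInMeasure.exists_seq_tendsto_ae`).

References: J.-F. Burnol, arXiv:math/0203120v7 [Burnol2004b] §1 p. 4 (TeX l.350–355: the Mellin
transform as a unitary identification of `L²(0,∞;dt)` with `L²` of the critical line) and §4
(TeX l.626–645: `𝕃²` Hardy space of the right Mellin transforms of `L²(a,∞)`-type data, boundary
values on the critical line); E. C. Titchmarsh, *Introduction to the theory of Fourier integrals*
(1948), Thm. 71 (secondary, not held).  Mathlib search: `mellin_cpow_smul`, `MellinConvergent.cpow_smul`,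
`tendsto_integral_filter_of_dominated_convergence`, `tendstoInMeasure_of_tendsto_eLpNorm`,
`TendstoInMeasure.exists_seq_tendsto_ae`, `MemLp.integrable_mul`; no Mathlib or tree statement on
`L²` boundary values of Mellin transforms (`lean search 'boundary value|HardyRight|mellinL2'`: only
`BurnolHardyRightPaleyWiener.lean`, which treats the Paley–Wiener side at function level).
-/

noncomputable section

open MeasureTheory Real Complex Set Filter FourierTransform
open scoped ENNReal Topology

namespace Literature.Analysis.FunctionSpaces

namespace MellinL2

/-! ### Absolute convergence of `𝓜k` on `Re s < ½` for `k ∈ L²` vanishing near `0` -/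

/-- For `a > 0` and `Re s < ½` the weight `1_{(a,∞)}(t)·t^{s−1}` is square integrable on `(0,∞)`
(`∫_a^∞ t^{2Re s − 2} dt < ∞`). [cite: Burnol2004b, §4 (arXiv:math/0203120v7, TeX l.626–645)] -/
theorem memLp_indicator_cpow {a : ℝ} (ha : 0 < a) {s : ℂ} (hs : s.re < 1 / 2) :
    MemLp (fun t : ℝ ↦ (Ioi a).indicator (fun t : ℝ ↦ (t : ℂ) ^ (s - 1)) t) 2
      (volume.restrict (Ioi (0:ℝ))) := by
  have hmeas : AEStronglyMeasurable
      (fun t : ℝ ↦ (Ioi a).indicator (fun t : ℝ ↦ (t : ℂ) ^ (s - 1)) t)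
      (volume.restrict (Ioi (0:ℝ))) :=
    ((Complex.continuous_ofReal.measurable.pow_const (s - 1)).indicator measurableSet_Ioi)
      |>.aestronglyMeasurable
  rw [memLp_two_iff_integrable_sq_norm hmeas]
  have hint : IntegrableOn (fun t : ℝ ↦ t ^ (2 * (s.re - 1))) (Ioi a) volume :=
    integrableOn_Ioi_rpow_of_lt (by linarith) ha
  have hint' : Integrable ((Ioi a).indicator fun t : ℝ ↦ t ^ (2 * (s.re - 1)))
      (volume.restrict (Ioi (0:ℝ))) :=
    (integrable_indicator_iff measurableSet_Ioi).2 (hint.mono_measure Measure.restrict_le_self)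
  refine hint'.congr (Eventually.of_forall fun t ↦ ?_)
  dsimp only
  by_cases ht : t ∈ Ioi a
  · have ht0 : 0 < t := ha.trans ht
    rw [indicator_of_mem ht, indicator_of_mem ht, Complex.norm_cpow_eq_rpow_re_of_pos ht0, sub_re,
      one_re, ← Real.rpow_two, ← Real.rpow_mul ht0.le]
    congr 1
    ring
  · rw [indicator_of_notMem ht, indicator_of_notMem ht, norm_zero, zero_pow two_ne_zero]

/-- **`𝓜k` converges absolutely on `Re s < ½`** for `k ∈ L²(0,∞)` vanishing a.e. on `(0,a]`, `a > 0`
(Cauchy–Schwarz: `∫_a^∞ |k| t^{Re s−1} dt ≤ ‖k‖₂ (∫_a^∞ t^{2Re s−2}dt)^{1/2}`); in right-Mellin notation: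
`k̂(w)` converges absolutely on `Re w > ½`. [cite: Burnol2004b, §4 (arXiv:math/0203120v7, TeX l.626–645)] -/
theorem mellinConvergent_of_ae_eq_zero {k : ℝ → ℂ} (hk2 : MemLp k 2 (volume.restrict (Ioi (0:ℝ))))
    {a : ℝ} (ha : 0 < a) (hk0 : ∀ᵐ t ∂(volume.restrict (Ioi (0:ℝ))), t ≤ a → k t = 0)
    {s : ℂ} (hs : s.re < 1 / 2) : MellinConvergent k s := by
  have hint := (memLp_indicator_cpow ha hs).integrable_mul hk2
  unfold MellinConvergent IntegrableOn
  refine hint.congr ?_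
  filter_upwards [hk0] with t ht
  simp only [Pi.mul_apply, smul_eq_mul]
  by_cases hta : t ∈ Ioi a
  · rw [indicator_of_mem hta]
  · rw [indicator_of_notMem hta, ht (not_lt.1 hta), mul_zero, mul_zero]

/-! ### The damped functions `k_ε = t^{−ε} k` -/

/-- `t^{−ε} ≤ e^{|log a|}` for `t > a > 0` and `0 ≤ ε ≤ 1` (a uniform bound for the dominated
convergence). [cite: Burnol2004b, §4 (arXiv:math/0203120v7, TeX l.626–645)] -/
theorem rpow_neg_le_exp_abs_log {a t ε : ℝ} (ha : 0 < a) (hat : a < t) (hε0 : 0 ≤ ε) (hε1 : ε ≤ 1) :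
    t ^ (-ε) ≤ Real.exp |Real.log a| := by
  calc t ^ (-ε) ≤ a ^ (-ε) := Real.rpow_le_rpow_of_nonpos ha hat.le (by linarith)
    _ = Real.exp (Real.log a * (-ε)) := Real.rpow_def_of_pos ha _
    _ ≤ Real.exp |Real.log a| := Real.exp_le_exp.2 (by
        calc Real.log a * (-ε) ≤ |Real.log a * (-ε)| := le_abs_self _
          _ = |Real.log a| * ε := by rw [abs_mul, abs_neg, abs_of_nonneg hε0]
          _ ≤ |Real.log a| * 1 := by gcongr
          _ = |Real.log a| := mul_one _)

/-- `‖t^{−ε}‖ = t^{−ε}` (`t > 0`, complex power with real exponent). [cite: Burnol2004b, §4 (arXiv:math/0203120v7, TeX l.626–645)] -/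
theorem norm_cpow_neg_ofReal {t : ℝ} (ht : 0 < t) (ε : ℝ) : ‖(t : ℂ) ^ (-(ε : ℂ))‖ = t ^ (-ε) := by
  rw [Complex.norm_cpow_eq_rpow_re_of_pos ht]
  simp

/-- The damped function `k_ε(t) = t^{−ε}k(t)` is a.e. strongly measurable. [cite: Burnol2004b, §4 (arXiv:math/0203120v7, TeX l.626–645)] -/
theorem aestronglyMeasurable_cpow_smul {k : ℝ → ℂ} (hk : AEStronglyMeasurable k (volume.restrict (Ioi (0:ℝ))))
    (ε : ℝ) :
    AEStronglyMeasurable (fun t : ℝ ↦ (t : ℂ) ^ (-(ε : ℂ)) • k t) (volume.restrict (Ioi (0:ℝ))) :=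
  (Complex.continuous_ofReal.measurable.pow_const _).aestronglyMeasurable.smul hk

/-- For `k ∈ L²` vanishing a.e. on `(0,a]`: `‖k_ε(t)‖ ≤ a^{−ε}‖k(t)‖` a.e. (`ε ≥ 0`). [cite: Burnol2004b, §4 (arXiv:math/0203120v7, TeX l.626–645)] -/
theorem norm_cpow_smul_le_ae {k : ℝ → ℂ} {a : ℝ} (ha : 0 < a)
    (hk0 : ∀ᵐ t ∂(volume.restrict (Ioi (0:ℝ))), t ≤ a → k t = 0) {ε : ℝ} (hε : 0 ≤ ε) :
    ∀ᵐ t ∂(volume.restrict (Ioi (0:ℝ))), ‖((t : ℝ) : ℂ) ^ (-(ε : ℂ)) • k t‖ ≤ a ^ (-ε) * ‖k t‖ := by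
  filter_upwards [hk0, ae_restrict_mem measurableSet_Ioi] with t ht ht0
  by_cases hta : t ≤ a
  · rw [ht hta, smul_zero, norm_zero, mul_zero]
  · rw [norm_smul, norm_cpow_neg_ofReal ht0]
    exact mul_le_mul_of_nonneg_right
      (Real.rpow_le_rpow_of_nonpos ha (not_le.1 hta).le (by linarith)) (norm_nonneg _)

/-- `k_ε = t^{−ε}k ∈ L²((0,∞))` for `k ∈ L²` vanishing a.e. on `(0,a]` and `ε ≥ 0`. [cite: Burnol2004b, §4 (arXiv:math/0203120v7, TeX l.626–645)] -/
theorem memLp_cpow_smul {k : ℝ → ℂ} (hk2 : MemLp k 2 (volume.restrict (Ioi (0:ℝ)))) {a : ℝ}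
    (ha : 0 < a) (hk0 : ∀ᵐ t ∂(volume.restrict (Ioi (0:ℝ))), t ≤ a → k t = 0) {ε : ℝ} (hε : 0 ≤ ε) :
    MemLp (fun t : ℝ ↦ (t : ℂ) ^ (-(ε : ℂ)) • k t) 2 (volume.restrict (Ioi (0:ℝ))) :=
  MemLp.of_le_mul hk2 (aestronglyMeasurable_cpow_smul hk2.1 ε) (norm_cpow_smul_le_ae ha hk0 hε)

/-- `k_ε` still vanishes a.e. on `(0,a]`. [cite: Burnol2004b, §4 (arXiv:math/0203120v7, TeX l.626–645)] -/
theorem cpow_smul_ae_eq_zero {k : ℝ → ℂ} {a : ℝ}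
    (hk0 : ∀ᵐ t ∂(volume.restrict (Ioi (0:ℝ))), t ≤ a → k t = 0) (ε : ℝ) :
    ∀ᵐ t ∂(volume.restrict (Ioi (0:ℝ))), t ≤ a → (t : ℂ) ^ (-(ε : ℂ)) • k t = 0 := by
  filter_upwards [hk0] with t ht hta
  rw [ht hta, smul_zero]

/-- `𝓜k_ε` converges absolutely on the critical line (`ε > 0`): `k_ε ∈ L¹(t^{−1/2}dt)`.
[cite: Burnol2004b, §4 (arXiv:math/0203120v7, TeX l.626–645)] -/
theorem mellinConvergent_cpow_smul_half {k : ℝ → ℂ} (hk2 : MemLp k 2 (volume.restrict (Ioi (0:ℝ))))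
    {a : ℝ} (ha : 0 < a) (hk0 : ∀ᵐ t ∂(volume.restrict (Ioi (0:ℝ))), t ≤ a → k t = 0) {ε : ℝ}
    (hε : 0 < ε) : MellinConvergent (fun t : ℝ ↦ (t : ℂ) ^ (-(ε : ℂ)) • k t) (1 / 2 : ℂ) := by
  rw [MellinConvergent.cpow_smul]
  refine mellinConvergent_of_ae_eq_zero hk2 ha hk0 ?_
  simp only [add_re, neg_re, ofReal_re, one_div]
  norm_num [hε]

/-! ### `k_ε → k` in `L²` as `ε → 0⁺` -/

/-- **`k_ε → k` in `L²((0,∞))`** (`ε → 0⁺`), squared-integral form: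
`∫₀^∞ ‖t^{−ε}k(t) − k(t)‖² dt → 0` (dominated convergence: `|t^{−ε} − 1| ≤ e^{|log a|} + 1` on `(a,∞)`
for `ε ≤ 1`, and `t^{−ε} → 1`). [cite: Burnol2004b, §4 (arXiv:math/0203120v7, TeX l.626–645)] -/
theorem tendsto_integral_norm_sq_cpow_smul_sub {k : ℝ → ℂ}
    (hk2 : MemLp k 2 (volume.restrict (Ioi (0:ℝ)))) {a : ℝ} (ha : 0 < a)
    (hk0 : ∀ᵐ t ∂(volume.restrict (Ioi (0:ℝ))), t ≤ a → k t = 0) :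
    Tendsto (fun ε : ℝ ↦ ∫ t in Ioi (0:ℝ), ‖(t : ℂ) ^ (-(ε : ℂ)) • k t - k t‖ ^ 2)
      (𝓝[>] 0) (𝓝 0) := by
  set C : ℝ := Real.exp |Real.log a| + 1 with hC
  have hk2' : Integrable (fun t : ℝ ↦ ‖k t‖ ^ 2) (volume.restrict (Ioi (0:ℝ))) :=
    (memLp_two_iff_integrable_sq_norm hk2.1).1 hk2
  have h := tendsto_integral_filter_of_dominated_convergence
    (μ := volume.restrict (Ioi (0:ℝ))) (l := 𝓝[>] (0:ℝ))
    (F := fun (ε : ℝ) (t : ℝ) ↦ ‖(t : ℂ) ^ (-(ε : ℂ)) • k t - k t‖ ^ 2) (f := fun _ ↦ (0:ℝ))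
    (fun t ↦ C ^ 2 * ‖k t‖ ^ 2) ?_ ?_ (hk2'.const_mul _) ?_
  · simpa only [integral_zero] using h
  · -- measurability
    refine Eventually.of_forall fun ε ↦ ?_
    exact (((aestronglyMeasurable_cpow_smul hk2.1 ε).sub hk2.1).norm.aemeasurable.pow_const 2)
      |>.aestronglyMeasurable
  · -- domination for `0 < ε < 1`
    filter_upwards [Ioo_mem_nhdsGT (zero_lt_one' ℝ)] with ε hε
    filter_upwards [hk0, ae_restrict_mem measurableSet_Ioi] with t ht ht0
    rw [Real.norm_eq_abs, abs_pow, abs_norm]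
    have hle : ‖(t : ℂ) ^ (-(ε : ℂ)) • k t - k t‖ ≤ C * ‖k t‖ := by
      by_cases hta : t ≤ a
      · rw [ht hta, smul_zero, sub_zero, norm_zero, mul_zero]
      · have hat : a < t := not_le.1 hta
        have hεt : t ^ (-ε) ≤ Real.exp |Real.log a| :=
          rpow_neg_le_exp_abs_log ha hat hε.1.le hε.2.le
        rw [show (t : ℂ) ^ (-(ε : ℂ)) • k t - k t = ((t : ℂ) ^ (-(ε : ℂ)) - 1) • k t by
          rw [sub_smul, one_smul], norm_smul]
        refine mul_le_mul_of_nonneg_right ?_ (norm_nonneg _)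
        calc ‖(t : ℂ) ^ (-(ε : ℂ)) - 1‖ ≤ ‖(t : ℂ) ^ (-(ε : ℂ))‖ + ‖(1 : ℂ)‖ := norm_sub_le _ _
          _ = t ^ (-ε) + 1 := by rw [norm_cpow_neg_ofReal ht0, norm_one]
          _ ≤ C := by rw [hC]; gcongr
    calc ‖(t : ℂ) ^ (-(ε : ℂ)) • k t - k t‖ ^ 2 ≤ (C * ‖k t‖) ^ 2 := by
          gcongr
      _ = C ^ 2 * ‖k t‖ ^ 2 := by ring
  · -- pointwise limit
    filter_upwards [ae_restrict_mem measurableSet_Ioi] with t ht0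
    have ht0' : (t : ℂ) ≠ 0 := Complex.ofReal_ne_zero.2 (ne_of_gt ht0)
    have h1 : Tendsto (fun ε : ℝ ↦ (t : ℂ) ^ (-(ε : ℂ))) (𝓝 0) (𝓝 1) := by
      have hc : Continuous fun ε : ℝ ↦ (t : ℂ) ^ (-(ε : ℂ)) :=
        continuous_iff_continuousAt.2 fun ε ↦
          (continuousAt_const_cpow ht0').comp (Complex.continuous_ofReal.neg).continuousAt
      simpa using hc.tendsto 0
    have h2 := ((h1.smul_const (k t)).sub_const (k t)).norm.pow 2
    simp only [one_smul, sub_self, norm_zero, ne_eq, OfNat.ofNat_ne_zero, not_false_eq_true,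
      zero_pow] at h2
    exact h2.mono_left nhdsWithin_le_nhds

/-- **`k_ε → k` in `L²((0,∞))`** (`ε → 0⁺`), seminorm form: `‖t^{−ε}k − k‖_{L²(0,∞)} → 0`.
[cite: Burnol2004b, §4 (arXiv:math/0203120v7, TeX l.626–645)] -/
theorem tendsto_eLpNorm_cpow_smul_sub {k : ℝ → ℂ} (hk2 : MemLp k 2 (volume.restrict (Ioi (0:ℝ))))
    {a : ℝ} (ha : 0 < a) (hk0 : ∀ᵐ t ∂(volume.restrict (Ioi (0:ℝ))), t ≤ a → k t = 0) :
    Tendsto (fun ε : ℝ ↦ eLpNorm (fun t : ℝ ↦ (t : ℂ) ^ (-(ε : ℂ)) • k t - k t) 2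
      (volume.restrict (Ioi (0:ℝ)))) (𝓝[>] 0) (𝓝 0) := by
  have h := tendsto_integral_norm_sq_cpow_smul_sub hk2 ha hk0
  have h' : Tendsto (fun ε : ℝ ↦ ENNReal.ofReal
      ((∫ t in Ioi (0:ℝ), ‖(t : ℂ) ^ (-(ε : ℂ)) • k t - k t‖ ^ 2) ^ (2 : ℝ)⁻¹)) (𝓝[>] 0) (𝓝 0) := by
    have h1 := h.rpow_const (p := (2 : ℝ)⁻¹) (Or.inr (by norm_num))
    rw [Real.zero_rpow (by norm_num)] at h1
    simpa only [ENNReal.ofReal_zero] using ENNReal.tendsto_ofReal h1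
  refine (tendsto_congr' ?_).2 h'
  filter_upwards [self_mem_nhdsWithin] with ε (hε : 0 < ε)
  have hmem : MemLp (fun t : ℝ ↦ (t : ℂ) ^ (-(ε : ℂ)) • k t - k t) 2 (volume.restrict (Ioi (0:ℝ))) :=
    (memLp_cpow_smul hk2 ha hk0 hε.le).sub hk2
  rw [hmem.eLpNorm_eq_integral_rpow_norm two_ne_zero ENNReal.ofNat_ne_top, ENNReal.toReal_ofNat]
  congr 3
  funext t
  rw [Real.rpow_two]

/-- The `L²` isometry `mellinL2` preserves `eLpNorm` of representatives. [cite: Burnol2004b, §1 p. 4 (arXiv:math/0203120v7, TeX l.350–355)] -/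
theorem eLpNorm_coe_mellinL2 (x : Lp ℂ 2 (volume.restrict (Ioi (0:ℝ)))) :
    eLpNorm (mellinL2 x : ℝ → ℂ) 2 volume = eLpNorm (x : ℝ → ℂ) 2 (volume.restrict (Ioi (0:ℝ))) := by
  have h1 := Lp.norm_def (mellinL2 x)
  have h2 := Lp.norm_def x
  rw [norm_mellinL2] at h1
  exact (ENNReal.toReal_eq_toReal_iff' (Lp.eLpNorm_ne_top _) (Lp.eLpNorm_ne_top _)).1
    (h1.symm.trans h2)

/-! ### Boundary values: `𝓜k(½ − ε + 2πiξ) → mellinL2 k` in `L²(ℝ)` -/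

/-- For `ε > 0` the Mellin–Plancherel transform of `k_ε = t^{−ε}k` IS the Mellin integral of `k` on the
line `Re s = ½ − ε`: `mellinL2 [k_ε] = (ξ ↦ 𝓜k(½ − ε + 2πiξ))` a.e. (the dictionary of
`MellinPlancherelL2` for `k_ε ∈ L¹(t^{−1/2}dt) ∩ L²`, and `𝓜(t^{−ε}k)(s) = 𝓜k(s − ε)`).
[cite: Burnol2004b, §4 (arXiv:math/0203120v7, TeX l.626–645)] -/
theorem mellinL2_toLp_cpow_smul_ae_eq {k : ℝ → ℂ} (hk2 : MemLp k 2 (volume.restrict (Ioi (0:ℝ))))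
    {a : ℝ} (ha : 0 < a) (hk0 : ∀ᵐ t ∂(volume.restrict (Ioi (0:ℝ))), t ≤ a → k t = 0) {ε : ℝ}
    (hε : 0 < ε) :
    (mellinL2 ((memLp_cpow_smul hk2 ha hk0 hε.le).toLp _) : ℝ → ℂ) =ᵐ[volume]
      fun ξ : ℝ ↦ mellin k (1 / 2 - ε + 2 * π * ξ * I) := by
  refine (mellinL2_toLp_ae_eq_mellin (memLp_cpow_smul hk2 ha hk0 hε.le)
    (mellinConvergent_cpow_smul_half hk2 ha hk0 hε)).trans (Eventually.of_forall fun ξ ↦ ?_)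
  dsimp only
  rw [mellin_cpow_smul]
  congr 1
  ring

/-- **Boundary values in `L²`**: for `k ∈ L²(0,∞)` vanishing a.e. on `(0,a]` (`a > 0`), the
functions `ξ ↦ 𝓜k(½ − ε + 2πiξ)` (absolutely convergent Mellin integrals on the lines `Re s = ½ − ε`)
converge in `L²(ℝ)`-seminorm, as `ε → 0⁺`, to (a representative of) `mellinL2 k`.  In Burnol's
right-Mellin notation: `τ ↦ k̂(½ + ε + iτ)` converges in `L²` to the boundary function `k̂(½ + iτ)` of
the Hardy-space element `k̂`. [cite: Burnol2004b, §4 (arXiv:math/0203120v7, TeX l.626–645)] -/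
theorem tendsto_eLpNorm_mellin_sub_mellinL2 {k : ℝ → ℂ} (hk2 : MemLp k 2 (volume.restrict (Ioi (0:ℝ))))
    {a : ℝ} (ha : 0 < a) (hk0 : ∀ᵐ t ∂(volume.restrict (Ioi (0:ℝ))), t ≤ a → k t = 0) :
    Tendsto (fun ε : ℝ ↦ eLpNorm
        (fun ξ : ℝ ↦ mellin k (1 / 2 - ε + 2 * π * ξ * I) - (mellinL2 (hk2.toLp k) : ℝ → ℂ) ξ)
        2 volume) (𝓝[>] 0) (𝓝 0) := by
  refine (tendsto_congr' ?_).1 (tendsto_eLpNorm_cpow_smul_sub hk2 ha hk0)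
  filter_upwards [self_mem_nhdsWithin] with ε (hε : 0 < ε)
  have hmemε := memLp_cpow_smul hk2 ha hk0 hε.le
  -- `t`-side: `‖k_ε − k‖ = ‖[k_ε] − [k]‖`
  have e1 : eLpNorm (fun t : ℝ ↦ (t : ℂ) ^ (-(ε : ℂ)) • k t - k t) 2 (volume.restrict (Ioi (0:ℝ))) =
      eLpNorm (((hmemε.toLp _ - hk2.toLp k : Lp ℂ 2 (volume.restrict (Ioi (0:ℝ)))) : ℝ → ℂ)) 2
        (volume.restrict (Ioi (0:ℝ))) := by
    refine eLpNorm_congr_ae ?_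
    filter_upwards [Lp.coeFn_sub (hmemε.toLp _) (hk2.toLp k), hmemε.coeFn_toLp, hk2.coeFn_toLp]
      with t h1 h2 h3
    rw [h1, Pi.sub_apply, h2, h3]
  -- `ξ`-side: `‖𝓜k(½ − ε + 2πi·) − mellinL2 k‖ = ‖mellinL2 ([k_ε] − [k])‖`
  have e2 : eLpNorm (fun ξ : ℝ ↦ mellin k (1 / 2 - ε + 2 * π * ξ * I) -
        (mellinL2 (hk2.toLp k) : ℝ → ℂ) ξ) 2 volume =
      eLpNorm ((mellinL2 (hmemε.toLp _ - hk2.toLp k) : Lp ℂ 2 (volume : Measure ℝ)) : ℝ → ℂ)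
        2 volume := by
    refine eLpNorm_congr_ae ?_
    rw [map_sub]
    filter_upwards [mellinL2_toLp_cpow_smul_ae_eq hk2 ha hk0 hε,
      Lp.coeFn_sub (mellinL2 (hmemε.toLp _)) (mellinL2 (hk2.toLp k))] with ξ h1 h2
    rw [h2, Pi.sub_apply, h1]
  rw [e2, eLpNorm_coe_mellinL2, e1]

/-- **Identification of the boundary values** (the corollary consumed by Burnol's Prop. 4.1 (ii)):
let `k ∈ L²(0,∞)` vanish a.e. on `(0,a]` (`a > 0`), and let `K : ℂ → ℂ` agree with the Mellin
integral `𝓜k` on a strip `½ − δ < Re s < ½` and be continuous from the open half-plane `Re s < ½` at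
almost every point `½ + 2πiξ` of the critical line (e.g. `K` holomorphic across the line).  Then
`mellinL2 k = (ξ ↦ K(½ + 2πiξ))` a.e.: the `L²` boundary function IS `K` on the line (an `L²`-limit is
an a.e. limit along a subsequence `ε_n → 0⁺`). [cite: Burnol2004b, §4 (arXiv:math/0203120v7, TeX l.626–645)] -/
theorem mellinL2_ae_eq_of_continuousWithinAt {k : ℝ → ℂ}
    (hk2 : MemLp k 2 (volume.restrict (Ioi (0:ℝ)))) {a : ℝ} (ha : 0 < a)
    (hk0 : ∀ᵐ t ∂(volume.restrict (Ioi (0:ℝ))), t ≤ a → k t = 0) {K : ℂ → ℂ} {δ : ℝ} (hδ : 0 < δ)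
    (hKk : ∀ s : ℂ, 1 / 2 - δ < s.re → s.re < 1 / 2 → mellin k s = K s)
    (hK : ∀ᵐ ξ : ℝ, ContinuousWithinAt K {s : ℂ | s.re < 1 / 2} (1 / 2 + 2 * π * ξ * I)) :
    (mellinL2 (hk2.toLp k) : ℝ → ℂ) =ᵐ[volume] fun ξ : ℝ ↦ K (1 / 2 + 2 * π * ξ * I) := by
  -- the sequence `ε_n = δ/(n+2) ∈ (0, δ)`, `ε_n → 0`
  set ε : ℕ → ℝ := fun n ↦ δ / ((n : ℝ) + 2) with hε
  have hε0 : ∀ n, 0 < ε n := fun n ↦ by positivity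
  have hεδ : ∀ n, ε n < δ := fun n ↦ by
    rw [hε]
    exact div_lt_self hδ (by linarith [(Nat.cast_nonneg n : (0:ℝ) ≤ n)])
  have hεt : Tendsto ε atTop (𝓝 0) :=
    tendsto_const_nhds.div_atTop (tendsto_natCast_atTop_atTop.atTop_add tendsto_const_nhds)
  have hεw : Tendsto ε atTop (𝓝[>] 0) :=
    tendsto_nhdsWithin_iff.2 ⟨hεt, Eventually.of_forall hε0⟩
  -- `L²` convergence along `ε_n`, hence convergence in measure, hence a.e. along a subsequence
  have hT : Tendsto (fun n : ℕ ↦ eLpNorm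
      ((fun ξ : ℝ ↦ mellin k (1 / 2 - ε n + 2 * π * ξ * I)) - (mellinL2 (hk2.toLp k) : ℝ → ℂ))
      2 volume) atTop (𝓝 0) :=
    (tendsto_eLpNorm_mellin_sub_mellinL2 hk2 ha hk0).comp hεw
  have hmeas : ∀ n : ℕ, AEStronglyMeasurable (fun ξ : ℝ ↦ mellin k (1 / 2 - ε n + 2 * π * ξ * I))
      volume := fun n ↦
    (Lp.aestronglyMeasurable _).congr (mellinL2_toLp_cpow_smul_ae_eq hk2 ha hk0 (hε0 n))
  have hIn := tendstoInMeasure_of_tendsto_eLpNorm two_ne_zero hmeas (Lp.aestronglyMeasurable _) hT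
  obtain ⟨ns, hns, hlim⟩ := hIn.exists_seq_tendsto_ae
  filter_upwards [hlim, hK] with ξ h1 h2
  -- on the strip, `𝓜k = K`
  have h4 : (fun i : ℕ ↦ mellin k (1 / 2 - ε (ns i) + 2 * π * ξ * I)) =
      fun i : ℕ ↦ K (1 / 2 - ε (ns i) + 2 * π * ξ * I) := by
    funext i
    have hre : ((1 / 2 : ℂ) - (ε (ns i) : ℂ) + 2 * π * ξ * I).re = 1 / 2 - ε (ns i) := by simp
    apply hKk
    · rw [hre]; linarith [hεδ (ns i)]
    · rw [hre]; linarith [hε0 (ns i)]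
  rw [h4] at h1
  -- `K(½ − ε_{n_i} + 2πiξ) → K(½ + 2πiξ)` by continuity from the left half-plane
  have hs : Tendsto (fun i : ℕ ↦ (1 / 2 : ℂ) - (ε (ns i) : ℂ) + 2 * π * ξ * I) atTop
      (𝓝[{s : ℂ | s.re < 1 / 2}] (1 / 2 + 2 * π * ξ * I)) := by
    refine tendsto_nhdsWithin_iff.2 ⟨?_, Eventually.of_forall fun i ↦ ?_⟩
    · have hε' : Tendsto (fun i : ℕ ↦ ((ε (ns i) : ℝ) : ℂ)) atTop (𝓝 0) := by
        have h0 := (Complex.continuous_ofReal.tendsto 0).comp (hεt.comp hns.tendsto_atTop)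
        rw [Complex.ofReal_zero] at h0
        exact h0
      have := ((tendsto_const_nhds (x := (1 / 2 : ℂ))).sub hε').add
        (tendsto_const_nhds (x := (2 * π * ξ * I : ℂ)))
      simpa using this
    · show ((1 / 2 : ℂ) - (ε (ns i) : ℂ) + 2 * π * ξ * I).re < 1 / 2
      simp [hε0 (ns i)]
  exact tendsto_nhds_unique h1 (h2.tendsto.comp hs)

/-- The same identification for an `L²` CLASS `k` (`mellinL2 k = (ξ ↦ K(½ + 2πiξ))` a.e.).
[cite: Burnol2004b, §4 (arXiv:math/0203120v7, TeX l.626–645)] -/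
theorem mellinL2_ae_eq_of_continuousWithinAt' (k : Lp ℂ 2 (volume.restrict (Ioi (0:ℝ)))) {a : ℝ}
    (ha : 0 < a) (hk0 : ∀ᵐ t ∂(volume.restrict (Ioi (0:ℝ))), t ≤ a → (k : ℝ → ℂ) t = 0) {K : ℂ → ℂ}
    {δ : ℝ} (hδ : 0 < δ)
    (hKk : ∀ s : ℂ, 1 / 2 - δ < s.re → s.re < 1 / 2 → mellin (k : ℝ → ℂ) s = K s)
    (hK : ∀ᵐ ξ : ℝ, ContinuousWithinAt K {s : ℂ | s.re < 1 / 2} (1 / 2 + 2 * π * ξ * I)) :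
    (mellinL2 k : ℝ → ℂ) =ᵐ[volume] fun ξ : ℝ ↦ K (1 / 2 + 2 * π * ξ * I) := by
  have h := mellinL2_ae_eq_of_continuousWithinAt (Lp.memLp k) ha hk0 hδ hKk hK
  rwa [Lp.toLp_coeFn] at h

/-- Hypothesis conversion: vanishing a.e. on the OPEN interval `(0,a)` gives vanishing a.e. on the
closed `(0, a/2]` (feed `a/2` to the statements above). [cite: Burnol2004b, §4 (arXiv:math/0203120v7, TeX l.626–645)] -/
theorem ae_imp_le_half_of_ae_imp_lt {μ : Measure ℝ} {k : ℝ → ℂ} {a : ℝ} (ha : 0 < a)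
    (h : ∀ᵐ t ∂μ, t < a → k t = 0) : ∀ᵐ t ∂μ, t ≤ a / 2 → k t = 0 := by
  filter_upwards [h] with t ht hta
  exact ht (by linarith)

end MellinL2

end Literature.Analysis.FunctionSpaces

end
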